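import Mathlib
import Summits.MatrixMultiplication.MatrixMultiplication.Theorems.FidelityWitnessesFidelityGapTwoSixExplicitGap
import Literature.Computability.AlgebraicComplexity.TensorApolarityForms

/-!
# `FidelityGapTwoSixExplicit` — `F ⊗ A*`, its image `F·A*`, and the kernel `Z_F`

Part of the proof of `FidelityWitnesses.FidelityGapTwoSixExplicit` (stmt-MatrixMultiplication-14041); see
`FidelityWitnessesFidelityGapTwoSixExplicitDefs.lean` for the line of argument.  Here: `dim (F ⊗ A*) = 4 dim F`;
`phiA (F ⊗ A*) = TensorApolarity.prodA F` (the tree's product space); the kernel `Z_F` of `phiA` on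
`F ⊗ A*` (`zSub F`) has `dim ≥ 4 dim F − dim F·A*`, consists of alternating arrays, inherits the slice
defect of `F`, hence (gap inequality) lies within `√(2θ)` of `kerSpan`.
-/

noncomputable section

namespace Summit.MatrixMultiplication.MatrixMultiplication.Theorems.GapTwoSixExplicit

-- single-conjunct summit: the `Summit.<S>.<P>` prefix repeats `MatrixMultiplication` by design (D-0017)
set_option linter.dupNamespace false

open scoped BigOperators ComplexConjugate InnerProductSpace
open Literature.Computability.AlgebraicComplexity Module

/-! ## `F ⊗ A*`: dimension and image under the symmetrisation map -/

/-- `F ⊗ A* ≃ (A-index → F)`. [folklore] -/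
def tensorSubEquiv (F : Submodule ℂ (P2 × P2 → ℂ)) : tensorSub F ≃ₗ[ℂ] (P2 → F) where
  toFun z := fun a => ⟨fun p => (z : V64) (p, a), z.2 a⟩
  map_add' z z' := by funext a; rfl
  map_smul' c z := by funext a; rfl
  invFun g := ⟨WithLp.toLp 2 fun q => (g q.2 : P2 × P2 → ℂ) q.1, fun a => (g a).2⟩
  left_inv z := by
    apply Subtype.ext
    rfl
  right_inv g := by
    funext a
    rfl

/-- `dim (F ⊗ A*) = 4 · dim F`. [folklore] -/
theorem finrank_tensorSub (F : Submodule ℂ (P2 × P2 → ℂ)) :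
    finrank ℂ (tensorSub F) = 4 * finrank ℂ F := by
  rw [LinearEquiv.finrank_eq (tensorSubEquiv F), Module.finrank_pi_fintype]
  simp [Finset.sum_const, Finset.card_univ]

/-- `phiA` on an array of `F ⊗ A*` is the sum of the products of its slices with the dual basis:
`phiA z = Σ_a mulA (z(·,a)) e_a`. [folklore] -/
theorem phiA_eq_sum_mulA (z : V64) :
    phiA z = ∑ a : P2, TensorApolarity.mulA (fun p => z (p, a)) (Pi.single a 1) := by
  funext q
  obtain ⟨k, k', m⟩ := q
  rw [Finset.sum_apply]
  simp only [phiA, LinearMap.coe_mk, AddHom.coe_mk, TensorApolarity.mulA_apply]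
  rw [Finset.sum_add_distrib]
  have h1 : (∑ a : P2, z ((k, m), a) * (Pi.single a (1 : ℂ) : P2 → ℂ) k') = z ((k, m), k') := by
    rw [Finset.sum_eq_single k']
    · simp
    · intro a _ ha; simp [Ne.symm ha]
    · intro h; exact absurd (Finset.mem_univ _) h
  have h2 : (∑ a : P2, z ((k', m), a) * (Pi.single a (1 : ℂ) : P2 → ℂ) k) = z ((k', m), k) := by
    rw [Finset.sum_eq_single k]
    · simp
    · intro a _ ha; simp [Ne.symm ha]
    · intro h; exact absurd (Finset.mem_univ _) h
  rw [h1, h2]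

/-- A product `f · e_x` is `phiA` of the pure array `f ⊗ e_x`. [folklore] -/
theorem mulA_single_eq_phiA (f : P2 × P2 → ℂ) (x : P2) :
    TensorApolarity.mulA f (Pi.single x 1)
      = phiA (WithLp.toLp 2 fun q : (P2 × P2) × P2 => if q.2 = x then f q.1 else 0) := by
  funext q
  obtain ⟨k, k', m⟩ := q
  simp only [phiA, LinearMap.coe_mk, AddHom.coe_mk, TensorApolarity.mulA_apply]
  by_cases h1 : k' = x <;> by_cases h2 : k = x <;> simp [h1, h2]

/-- **`phiA (F ⊗ A*) = F·A*`** (the tree's `TensorApolarity.prodA F`). [folklore] -/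
theorem map_phiA_tensorSub (F : Submodule ℂ (P2 × P2 → ℂ)) :
    (tensorSub F).map phiA = TensorApolarity.prodA F := by
  apply le_antisymm
  · rintro g ⟨z, hz, rfl⟩
    rw [phiA_eq_sum_mulA]
    exact Submodule.sum_mem _ fun a _ => TensorApolarity.mulA_single_mem_prodA (hz a) a
  · rw [TensorApolarity.prodA_le_iff]
    intro f hf x
    rw [mulA_single_eq_phiA]
    refine ⟨_, ?_, rfl⟩
    intro a
    by_cases h : a = x
    · subst h
      simpa using hf
    · simp only [if_neg h]
      exact F.zero_mem

/-! ## The kernel `Z_F = ker (phiA|_{F ⊗ A*})`: dimension, alternation, slice defect -/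

/-- The kernel of the `(210)`-map on `F ⊗ A*`, as a subspace of `V64`. -/
def zSub (F : Submodule ℂ (P2 × P2 → ℂ)) : Submodule ℂ V64 :=
  (LinearMap.ker (phiA.domRestrict (tensorSub F))).map (tensorSub F).subtype

/-- `Z_F ≤ F ⊗ A*`. [folklore] -/
theorem zSub_le (F : Submodule ℂ (P2 × P2 → ℂ)) : zSub F ≤ tensorSub F := by
  rintro z ⟨w, -, rfl⟩
  exact w.2

/-- `phiA` vanishes on `Z_F`. [folklore] -/
theorem phiA_eq_zero_of_mem_zSub {F : Submodule ℂ (P2 × P2 → ℂ)} {z : V64} (hz : z ∈ zSub F) :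
    phiA z = 0 := by
  obtain ⟨w, hw, rfl⟩ := hz
  simpa using hw

/-- **`dim Z_F ≥ 4·dim F − dim F·A*`** (rank–nullity). [folklore] -/
theorem finrank_zSub_ge (F : Submodule ℂ (P2 × P2 → ℂ)) :
    4 * finrank ℂ F ≤ finrank ℂ (zSub F) + finrank ℂ (TensorApolarity.prodA F) := by
  have h := LinearMap.finrank_range_add_finrank_ker (phiA.domRestrict (tensorSub F))
  rw [LinearMap.range_domRestrict, map_phiA_tensorSub, finrank_tensorSub] at h
  rw [zSub, Submodule.finrank_map_subtype_eq]
  omega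

/-- Elements of `Z_F` are alternating in the two `A`-indices. [folklore] -/
theorem antisym_of_mem_zSub {F : Submodule ℂ (P2 × P2 → ℂ)} {z : V64} (hz : z ∈ zSub F)
    (p : (P2 × P2) × P2) : z ((p.2, p.1.2), p.1.1) = -z p := by
  have h := congr_fun (phiA_eq_zero_of_mem_zSub hz) (p.1.1, (p.2, p.1.2))
  simp only [phiA, LinearMap.coe_mk, AddHom.coe_mk, Pi.zero_apply] at h
  obtain ⟨⟨k, m⟩, k'⟩ := p
  simp only at h ⊢
  linear_combination h

/-- The slices of an element of `F ⊗ A*` lie in `F`. [folklore] -/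
theorem slice_mem_of_mem_tensorSub {F : Submodule ℂ (P2 × P2 → ℂ)} {z : V64}
    (hz : z ∈ tensorSub F) (a : P2) : (fun p => z (p, a)) ∈ F := hz a

/-- **Slice defect of `Z_F`.**  If every `f ∈ F` almost annihilates the slices of `T`
(`Σ_c |Σ_p f p T c p|² ≤ θ Σ |f p|²`), then `Σ_{c,a} |sliceMap z (c,a)|² ≤ θ ‖z‖²` on `F ⊗ A*`.
[folklore] -/
theorem sum_norm_sq_sliceMap_le {F : Submodule ℂ (P2 × P2 → ℂ)} {θ : ℝ}
    (hθ : ∀ f ∈ F, (∑ c : P2, ‖∑ p : P2 × P2, f p * T2 c p.1 p.2‖ ^ 2) ≤ θ * ∑ p, ‖f p‖ ^ 2)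
    {z : V64} (hz : z ∈ tensorSub F) :
    (∑ ca : P2 × P2, ‖sliceMap z ca‖ ^ 2) ≤ θ * ‖z‖ ^ 2 := by
  have hL : (∑ ca : P2 × P2, ‖sliceMap z ca‖ ^ 2) = ∑ a : P2, ∑ c : P2, ‖sliceMap z (c, a)‖ ^ 2 := by
    rw [Fintype.sum_prod_type_right]
  have hR : ‖z‖ ^ 2 = ∑ a : P2, ∑ p : P2 × P2, ‖z (p, a)‖ ^ 2 := by
    rw [norm_sq_V64, Fintype.sum_prod_type_right]
  rw [hL, hR, Finset.mul_sum]
  refine Finset.sum_le_sum fun a _ => ?_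
  have h := hθ _ (hz a)
  simpa only [sliceMap, LinearMap.coe_mk, AddHom.coe_mk] using h

/-- **Distance of `Z_F` to the kernel.**  Under the slice-defect hypothesis, every `z ∈ Z_F` has
`‖z − kerProj z‖² ≤ 2θ ‖z‖²`. [folklore] -/
theorem norm_sq_sub_kerProj_le_of_mem_zSub {F : Submodule ℂ (P2 × P2 → ℂ)} {θ : ℝ}
    (hθ : ∀ f ∈ F, (∑ c : P2, ‖∑ p : P2 × P2, f p * T2 c p.1 p.2‖ ^ 2) ≤ θ * ∑ p, ‖f p‖ ^ 2)
    {z : V64} (hz : z ∈ zSub F) :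
    ‖z - kerProj z‖ ^ 2 ≤ 2 * θ * ‖z‖ ^ 2 := by
  have h1 := norm_sq_sub_kerProj_le z (antisym_of_mem_zSub hz)
  have h2 := sum_norm_sq_sliceMap_le hθ (zSub_le F hz)
  nlinarith

end Summit.MatrixMultiplication.MatrixMultiplication.Theorems.GapTwoSixExplicit

end
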